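import Mathlib
import Summits.Ventures.PercRepro2.StarHAlgebra

/-!
# The attachment coefficient `κ` of the hub-leaf in the hub masses (blind cell PercRepro2, night-1 g13;
NIGHT1-G13.md §3)

`a₃` pendant at an unmarked `u` that carries exactly the four coins `α, β, r, s` to `a₁, a₂, o, b`.  By
`HMFLeafRB.kappa_eq` the attachment coefficient `κ = 4 HMFc(½) − 2 HMFc(1)` of the leaf is a polynomial in
the masses of the contracted instance and the `f`-free `Q`-masses; at the contracted instance the mark sits
at `u`, so every mass is a hub mass at `u` (StarHMasses, `Xhat_star_h_cells`).  `kappaMassH` is that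
polynomial in the ten cells of the star-zeroed table at `u`, `G_ob, G′_ob`, the isolated term `X₀` and the
four coins — the κ-twin of `hmfcMassH`; `HMFStarLeafH.kappa_star_h` proves `κ = kappaMassH (table at u)`.
-/

namespace Summit.Ventures.PercRepro2

namespace StarH

section Ring

variable {R : Type*} [CommRing R]

/-- The attachment coefficient `κ` of the hub-leaf: `2 Z (A_L + A_H − D_o)(W − B_H) + 2 (Z − D)(A_L B_H +
A_H B_L − Z X̂) + (B_H − B_L)((A_L + A_H − D_o) S₃ − (Z − D) S₃o)` with every mass the hub mass at `u`. -/
def kappaMassH (LL LH LN HL HH HN NL NH NNt NNs Gob Gpob X0 al be r s : R) : R :=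
  2 * hubMass_Q LL LH LN HL HH HN NL NH NNt NNs al be r s *
      (hubMass_QoL LL LH LN HL HH HN NL NH NNt NNs al be r s + hubMass_QoH LL LH LN HL HH HN NL NH NNt NNs al be r s - (hubMass_PDoL LL LH LN HL HH HN NL NH NNt NNs al be r s + hubMass_PDoH LL LH LN HL HH HN NL NH NNt NNs al be r s)) *
      ((hubMass_PDbH LL LH LN HL HH HN NL NH NNt NNs al be r s + hubMass_TbH LL LH LN HL HH HN NL NH NNt NNs al be r s - hubMass_TbL LL LH LN HL HH HN NL NH NNt NNs al be r s) - hubMass_QbH LL LH LN HL HH HN NL NH NNt NNs al be r s) +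
    2 * (hubMass_Q LL LH LN HL HH HN NL NH NNt NNs al be r s - hubMass_PD LL LH LN HL HH HN NL NH NNt NNs al be r s) *
      (hubMass_QoL LL LH LN HL HH HN NL NH NNt NNs al be r s * hubMass_QbH LL LH LN HL HH HN NL NH NNt NNs al be r s + hubMass_QoH LL LH LN HL HH HN NL NH NNt NNs al be r s * hubMass_QbL LL LH LN HL HH HN NL NH NNt NNs al be r s - hubMass_Q LL LH LN HL HH HN NL NH NNt NNs al be r s * xhatH LL LH LN HL HH HN Gob Gpob X0 al be r s) +
    (hubMass_QbH LL LH LN HL HH HN NL NH NNt NNs al be r s - hubMass_QbL LL LH LN HL HH HN NL NH NNt NNs al be r s) *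
      ((hubMass_QoL LL LH LN HL HH HN NL NH NNt NNs al be r s + hubMass_QoH LL LH LN HL HH HN NL NH NNt NNs al be r s - (hubMass_PDoL LL LH LN HL HH HN NL NH NNt NNs al be r s + hubMass_PDoH LL LH LN HL HH HN NL NH NNt NNs al be r s)) * (hubMass_Tp LL LH LN HL HH HN NL NH NNt NNs al be r s - hubMass_T LL LH LN HL HH HN NL NH NNt NNs al be r s) -
        (hubMass_Q LL LH LN HL HH HN NL NH NNt NNs al be r s - hubMass_PD LL LH LN HL HH HN NL NH NNt NNs al be r s) * (hubMass_TpoL LL LH LN HL HH HN NL NH NNt NNs al be r s + hubMass_TpoH LL LH LN HL HH HN NL NH NNt NNs al be r s - hubMass_ToL LL LH LN HL HH HN NL NH NNt NNs al be r s - hubMass_ToH LL LH LN HL HH HN NL NH NNt NNs al be r s))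

end Ring

end StarH

end Summit.Ventures.PercRepro2
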